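import Mathlib
import Literature.Analysis.FluidPDE.AxisymmetricEuler
import HarnessLib.Audit

/-!
# Crux E `PowerGaugeEulerLiouville` (stmt-NavierStokesRegularity-19832), line `swirl-capacity`, stub D2 — part 3:
# TOOLS ON THE MERIDIONAL PLANE (the profile `g(z,ρ) = f(ρ,0,z)`, a scaled cut-off, ray Poincaré from the grounded axis)

Route `EulerZoomLiouville` (NavierStokesRegularity), crux E.  Line `swirl-capacity` (ns-idea-11 g3, LINE D), stub D2 `stub_axisCapacityFloor`
in the critic's power-lossy re-cut (idea-crit-8 g2 V29, price P3).  Real-analysis tools on `ℝ × ℝ` (coordinates `(z, ρ)`, sup norm) for the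
assembly in part 4 (`…SwirlCapacityAxisFloor`):

* `meridPt_eq`, `hasDerivAt_meridional_ray`, `abs_ray_deriv_le`, `meridional_contDiff_and_norm_fderiv_le` — the profile `f(ρ,0,z)` is `C¹` on the
  plane, `|∂_ρ f(ρ,0,z)| ≤ ‖∇f‖`, `‖∇(f∘m)‖ ≤ 2‖∇f‖`;
* `exists_scaled_bump` — a cut-off `χ_A` (`= 1` on `‖y‖ ≤ A`, `= 0` on `‖y‖ ≥ 2A`, `‖∇χ_A‖ ≤ C₁/A` with a universal `C₁`);
* `sq_le_ray_energy`, `poincare_square` — RAY POINCARÉ from the grounded axis: if `f = 0` on the axis then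
  `f(ρ,0,z)² ≤ 2A ∫_{[−2A,2A]} ‖∇f(s,0,z)‖² ds` (`|ρ| ≤ 2A`; FTC + Cauchy–Schwarz), hence `∫_{[−2A,2A]²} f∘m ² ≤ 8A² ∫_{[−2A,2A]²} ‖∇f∘m‖²`.

WHAT THIS IS NOT: not NS regularity, not the crux E — helper real analysis `--supports` stmt-19832.  [folklore]
-/

noncomputable section

set_option linter.dupNamespace false

open MeasureTheory Set Filter Topology Metric Function
open scoped NNReal ENNReal

namespace Summit.NavierStokesRegularity.NavierStokesRegularity.Theorems.PowerGaugeEulerLiouville.SwirlCapacity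

open Literature.Analysis Literature.Analysis.FluidPDE

/-! ### The meridional profile `g(z, ρ) = f(ρ, 0, z)` on `ℝ × ℝ` -/

/-- `(ρ, 0, z) = ρ • e₀ + z • e₂`. [folklore] -/
theorem meridPt_eq (z ρ : ℝ) :
    (WithLp.toLp 2 ![ρ, 0, z] : EuclideanSpace ℝ (Fin 3)) =
      ρ • EuclideanSpace.single (0 : Fin 3) (1 : ℝ) + z • EuclideanSpace.single (2 : Fin 3) (1 : ℝ) := by
  ext i
  fin_cases i <;> simp

/-- The meridional point vanishes on the axis: `cylRadius (0, 0, z) = 0`. [folklore] -/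
theorem cylRadius_meridPt_zero (z : ℝ) : cylRadius (WithLp.toLp 2 ![(0 : ℝ), 0, z] : EuclideanSpace ℝ (Fin 3)) = 0 := by
  rw [cylRadius_eq_zero_iff]
  simp

/-- The ray derivative: `∂_ρ f(ρ,0,z) = ∇f(ρ,0,z) · e₀`. [folklore] -/
theorem hasDerivAt_meridional_ray {f : EuclideanSpace ℝ (Fin 3) → ℝ} (hfd : Differentiable ℝ f) (z s : ℝ) :
    HasDerivAt (fun s : ℝ => f (WithLp.toLp 2 ![s, 0, z]))
      (fderiv ℝ f (WithLp.toLp 2 ![s, 0, z]) (EuclideanSpace.single (0 : Fin 3) (1 : ℝ))) s := by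
  have h1 : HasDerivAt (fun s : ℝ => (WithLp.toLp 2 ![s, 0, z] : EuclideanSpace ℝ (Fin 3)))
      (EuclideanSpace.single (0 : Fin 3) (1 : ℝ)) s := by
    have e : (fun s : ℝ => (WithLp.toLp 2 ![s, 0, z] : EuclideanSpace ℝ (Fin 3))) =
        fun s => s • EuclideanSpace.single (0 : Fin 3) (1 : ℝ) + z • EuclideanSpace.single (2 : Fin 3) (1 : ℝ) :=
      funext fun s => meridPt_eq z s
    rw [e]
    simpa using ((hasDerivAt_id s).smul_const (EuclideanSpace.single (0 : Fin 3) (1 : ℝ))).add_const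
      (z • EuclideanSpace.single (2 : Fin 3) (1 : ℝ))
  exact (hfd _).hasFDerivAt.comp_hasDerivAt s h1

/-- `|∂_ρ f(ρ,0,z)| ≤ ‖∇f(ρ,0,z)‖`. [folklore] -/
theorem abs_ray_deriv_le {f : EuclideanSpace ℝ (Fin 3) → ℝ} (x : EuclideanSpace ℝ (Fin 3)) :
    |fderiv ℝ f x (EuclideanSpace.single (0 : Fin 3) (1 : ℝ))| ≤ ‖fderiv ℝ f x‖ := by
  have h := (fderiv ℝ f x).le_opNorm (EuclideanSpace.single (0 : Fin 3) (1 : ℝ))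
  have hn0 : ‖EuclideanSpace.single (0 : Fin 3) (1 : ℝ)‖ = 1 := by simp
  rw [hn0, mul_one, Real.norm_eq_abs] at h
  exact h

/-- The meridional profile is `C¹` and `‖∇(f ∘ m)(y)‖ ≤ 2 ‖∇f(m y)‖` (`m(z,ρ) = ρ • e₀ + z • e₂`, `‖m′ v‖ ≤ |v₂| + |v₁| ≤ 2‖v‖`). [folklore] -/
theorem meridional_contDiff_and_norm_fderiv_le {f : EuclideanSpace ℝ (Fin 3) → ℝ} (hfd : ContDiff ℝ 1 f) :
    ContDiff ℝ 1 (fun y : ℝ × ℝ => f (WithLp.toLp 2 ![y.2, 0, y.1])) ∧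
      ∀ y : ℝ × ℝ, ‖fderiv ℝ (fun y : ℝ × ℝ => f (WithLp.toLp 2 ![y.2, 0, y.1])) y‖ ≤
        2 * ‖fderiv ℝ f (WithLp.toLp 2 ![y.2, 0, y.1])‖ := by
  obtain ⟨L, hL⟩ : ∃ L : ℝ × ℝ →L[ℝ] EuclideanSpace ℝ (Fin 3),
      L = (ContinuousLinearMap.snd ℝ ℝ ℝ).smulRight (EuclideanSpace.single (0 : Fin 3) (1 : ℝ)) +
        (ContinuousLinearMap.fst ℝ ℝ ℝ).smulRight (EuclideanSpace.single (2 : Fin 3) (1 : ℝ)) := ⟨_, rfl⟩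
  have hLy : ∀ y : ℝ × ℝ, L y = y.2 • EuclideanSpace.single (0 : Fin 3) (1 : ℝ) + y.1 • EuclideanSpace.single (2 : Fin 3) (1 : ℝ) := by
    intro y
    rw [hL]
    simp
  have hm : (fun y : ℝ × ℝ => (WithLp.toLp 2 ![y.2, 0, y.1] : EuclideanSpace ℝ (Fin 3))) = fun y => L y := by
    funext y
    rw [meridPt_eq, hLy]
  have hn0 : ‖EuclideanSpace.single (0 : Fin 3) (1 : ℝ)‖ = 1 := by simp
  have hn2 : ‖EuclideanSpace.single (2 : Fin 3) (1 : ℝ)‖ = 1 := by simp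
  have hLn : ∀ v : ℝ × ℝ, ‖L v‖ ≤ 2 * ‖v‖ := by
    intro v
    have h1 : ‖L v‖ ≤ ‖v.2 • EuclideanSpace.single (0 : Fin 3) (1 : ℝ)‖ + ‖v.1 • EuclideanSpace.single (2 : Fin 3) (1 : ℝ)‖ := by
      rw [hLy]
      exact norm_add_le _ _
    rw [norm_smul, norm_smul, hn0, hn2, mul_one, mul_one] at h1
    have h2 : ‖v.2‖ ≤ ‖v‖ := norm_snd_le v
    have h3 : ‖v.1‖ ≤ ‖v‖ := norm_fst_le v
    linarith
  have hcomp : (fun y : ℝ × ℝ => f (WithLp.toLp 2 ![y.2, 0, y.1])) = f ∘ fun y => L y := by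
    funext y; simp only [comp_apply, ← congrFun hm y]
  refine ⟨?_, fun y => ?_⟩
  · rw [hcomp]; exact hfd.comp L.contDiff
  · have hd : HasFDerivAt (f ∘ fun y => L y) ((fderiv ℝ f (L y)).comp L) y :=
      ((hfd.differentiable one_ne_zero) (L y)).hasFDerivAt.comp y L.hasFDerivAt
    rw [hcomp, hd.fderiv, show L y = WithLp.toLp 2 ![y.2, 0, y.1] from (congrFun hm y).symm]
    refine ContinuousLinearMap.opNorm_le_bound _ (by positivity) fun v => ?_
    calc ‖((fderiv ℝ f (WithLp.toLp 2 ![y.2, 0, y.1])).comp L) v‖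
        = ‖fderiv ℝ f (WithLp.toLp 2 ![y.2, 0, y.1]) (L v)‖ := rfl
      _ ≤ ‖fderiv ℝ f (WithLp.toLp 2 ![y.2, 0, y.1])‖ * ‖L v‖ := ContinuousLinearMap.le_opNorm _ _
      _ ≤ ‖fderiv ℝ f (WithLp.toLp 2 ![y.2, 0, y.1])‖ * (2 * ‖v‖) :=
          mul_le_mul_of_nonneg_left (hLn v) (norm_nonneg _)
      _ = 2 * ‖fderiv ℝ f (WithLp.toLp 2 ![y.2, 0, y.1])‖ * ‖v‖ := by ring

/-! ### A scaled cut-off on the plane -/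

/-- **Scaled bump.**  There is a universal `C₁ ≥ 0` such that for every `A > 0` there is a `C¹` function `χ : ℝ × ℝ → [0,1]` with `χ = 1` on
`‖y‖ ≤ A`, `χ = 0` on `‖y‖ ≥ 2A`, `∇χ = 0` on `‖y‖ > 2A` and `‖∇χ‖ ≤ C₁/A` everywhere (`χ(y) = χ₁(y/A)` for a fixed smooth bump `χ₁`).
[folklore] -/
theorem exists_scaled_bump : ∃ C₁ : ℝ, 0 ≤ C₁ ∧ ∀ A : ℝ, 0 < A → ∃ χ : ℝ × ℝ → ℝ, ContDiff ℝ 1 χ ∧ (∀ y, 0 ≤ χ y ∧ χ y ≤ 1) ∧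
    (∀ y, ‖y‖ ≤ A → χ y = 1) ∧ (∀ y, 2 * A ≤ ‖y‖ → χ y = 0) ∧ (∀ y, 2 * A < ‖y‖ → fderiv ℝ χ y = 0) ∧
    ∀ y, ‖fderiv ℝ χ y‖ ≤ C₁ / A := by
  set χ₁ : ContDiffBump (0 : ℝ × ℝ) := ⟨1, 2, one_pos, one_lt_two⟩ with hχ₁
  have hsmooth : ContDiff ℝ 1 (χ₁ : ℝ × ℝ → ℝ) := χ₁.contDiff
  obtain ⟨C₁, hC₁⟩ := (hsmooth.continuous_fderiv one_ne_zero).bounded_above_of_compact_support (χ₁.hasCompactSupport.fderiv (𝕜 := ℝ))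
  have hC₁0 : 0 ≤ C₁ := (norm_nonneg _).trans (hC₁ 0)
  refine ⟨C₁, hC₁0, fun A hA => ?_⟩
  set χ : ℝ × ℝ → ℝ := fun y => χ₁ (A⁻¹ • y) with hχ
  have hscale : ∀ y : ℝ × ℝ, HasFDerivAt χ ((fderiv ℝ χ₁ (A⁻¹ • y)).comp (A⁻¹ • ContinuousLinearMap.id ℝ (ℝ × ℝ))) y := by
    intro y
    have h1 : HasFDerivAt (fun y : ℝ × ℝ => A⁻¹ • y) (A⁻¹ • ContinuousLinearMap.id ℝ (ℝ × ℝ)) y :=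
      (ContinuousLinearMap.id ℝ (ℝ × ℝ)).hasFDerivAt.const_smul A⁻¹
    exact ((hsmooth.differentiable one_ne_zero) (A⁻¹ • y)).hasFDerivAt.comp y h1
  refine ⟨χ, hsmooth.comp (contDiff_const_smul _), fun y => ⟨χ₁.nonneg, χ₁.le_one⟩, fun y hy => ?_, fun y hy => ?_,
    fun y hy => ?_, fun y => ?_⟩
  · -- `= 1` on the small square
    refine χ₁.one_of_mem_closedBall ?_
    rw [mem_closedBall, dist_zero_right, norm_smul, Real.norm_eq_abs, abs_of_pos (inv_pos.2 hA)]
    show A⁻¹ * ‖y‖ ≤ 1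
    rw [inv_mul_le_iff₀ hA]; linarith
  · -- `= 0` off the large square
    refine χ₁.zero_of_le_dist ?_
    rw [dist_zero_right, norm_smul, Real.norm_eq_abs, abs_of_pos (inv_pos.2 hA)]
    show (2 : ℝ) ≤ A⁻¹ * ‖y‖
    rw [le_inv_mul_iff₀ hA]; linarith
  · -- `∇χ = 0` off the large closed square (locally zero)
    have hev : χ =ᶠ[𝓝 y] fun _ => (0 : ℝ) := by
      have hopen : IsOpen {w : ℝ × ℝ | 2 * A < ‖w‖} := isOpen_lt continuous_const continuous_norm
      filter_upwards [hopen.mem_nhds hy] with w hw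
      refine χ₁.zero_of_le_dist ?_
      rw [dist_zero_right, norm_smul, Real.norm_eq_abs, abs_of_pos (inv_pos.2 hA)]
      show (2 : ℝ) ≤ A⁻¹ * ‖w‖
      rw [le_inv_mul_iff₀ hA]
      have : 2 * A < ‖w‖ := hw
      linarith
    rw [hev.fderiv_eq]
    exact fderiv_const_apply _
  · -- the gradient bound
    rw [(hscale y).fderiv]
    calc ‖(fderiv ℝ χ₁ (A⁻¹ • y)).comp (A⁻¹ • ContinuousLinearMap.id ℝ (ℝ × ℝ))‖
        ≤ ‖fderiv ℝ χ₁ (A⁻¹ • y)‖ * ‖A⁻¹ • ContinuousLinearMap.id ℝ (ℝ × ℝ)‖ := ContinuousLinearMap.opNorm_comp_le _ _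
      _ ≤ C₁ * A⁻¹ := by
          refine mul_le_mul (hC₁ _) ?_ (norm_nonneg _) hC₁0
          rw [norm_smul, Real.norm_eq_abs, abs_of_pos (inv_pos.2 hA)]
          exact mul_le_of_le_one_right (inv_pos.2 hA).le ContinuousLinearMap.norm_id_le
      _ = C₁ / A := (div_eq_mul_inv _ _).symm

/-! ### Ray Poincaré from the grounded axis -/

/-- **Ray Poincaré, pointwise.**  If `f` is `C¹` and vanishes on the axis, then for `|ρ| ≤ 2A`:
`f(ρ,0,z)² ≤ 2A ∫_{[−2A,2A]} ‖∇f(s,0,z)‖² ds` (`f(ρ,0,z) = ∫₀^ρ ∂_s f(s,0,z) ds`, Cauchy–Schwarz). [folklore] -/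
theorem sq_le_ray_energy {f : EuclideanSpace ℝ (Fin 3) → ℝ} (hfd : ContDiff ℝ 1 f)
    (haxis : ∀ x : EuclideanSpace ℝ (Fin 3), cylRadius x = 0 → f x = 0) {A : ℝ} (hA : 0 < A) (z : ℝ) {ρ : ℝ} (hρ : |ρ| ≤ 2 * A) :
    ENNReal.ofReal (f (WithLp.toLp 2 ![ρ, 0, z]) ^ 2) ≤
      ENNReal.ofReal (2 * A) * ∫⁻ s in Icc (-(2 * A)) (2 * A), ENNReal.ofReal (‖fderiv ℝ f (WithLp.toLp 2 ![s, 0, z])‖ ^ 2) := by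
  set φ : ℝ → ℝ := fun s => f (WithLp.toLp 2 ![s, 0, z]) with hφ
  set φ' : ℝ → ℝ := fun s => fderiv ℝ f (WithLp.toLp 2 ![s, 0, z]) (EuclideanSpace.single (0 : Fin 3) (1 : ℝ)) with hφ'
  set N : ℝ → ℝ := fun s => ‖fderiv ℝ f (WithLp.toLp 2 ![s, 0, z])‖ with hN
  have hderiv : ∀ s, HasDerivAt φ (φ' s) s := fun s => hasDerivAt_meridional_ray (hfd.differentiable one_ne_zero) z s
  have hray : Continuous fun s : ℝ => (WithLp.toLp 2 ![s, 0, z] : EuclideanSpace ℝ (Fin 3)) := by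
    refine (PiLp.continuous_toLp 2 _).comp (continuous_pi fun i => ?_)
    fin_cases i
    · exact continuous_id
    · exact continuous_const
    · exact continuous_const
  have hφ'c : Continuous φ' := ((hfd.continuous_fderiv one_ne_zero).comp hray).clm_apply continuous_const
  have hNc : Continuous N := ((hfd.continuous_fderiv one_ne_zero).comp hray).norm
  have hN0 : ∀ s, 0 ≤ N s := fun s => norm_nonneg _
  have hφ0 : φ 0 = 0 := haxis _ (cylRadius_meridPt_zero z)
  -- FTC: `φ ρ = ∫₀^ρ φ'`
  have hftc : φ ρ = ∫ s in (0 : ℝ)..ρ, φ' s := by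
    have h := intervalIntegral.integral_eq_sub_of_hasDerivAt (a := 0) (b := ρ) (fun s _ => hderiv s)
      (hφ'c.intervalIntegrable _ _)
    rw [hφ0, sub_zero] at h
    exact h.symm
  -- `|φ ρ| ≤ ∫_{Ι 0 ρ} N`
  set I : Set ℝ := uIoc (0 : ℝ) ρ with hI
  have hIsub : I ⊆ Icc (-(2 * A)) (2 * A) := by
    intro s hs
    rw [hI, mem_uIoc] at hs
    have h1 := abs_le.1 hρ
    constructor <;> rcases hs with ⟨h2, h3⟩ | ⟨h2, h3⟩ <;> linarith
  have hNint : IntegrableOn N I := (hNc.integrableOn_Icc (a := -(2 * A)) (b := 2 * A)).mono_set hIsub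
  have habs : |φ ρ| ≤ ∫ s in I, N s := by
    rw [hftc, ← Real.norm_eq_abs]
    refine (intervalIntegral.norm_integral_le_integral_norm_uIoc).trans ?_
    refine setIntegral_mono_on ?_ hNint measurableSet_uIoc fun s _ => ?_
    · exact ((hφ'c.norm).integrableOn_Icc (a := -(2 * A)) (b := 2 * A)).mono_set hIsub
    · rw [Real.norm_eq_abs]
      exact abs_ray_deriv_le _
  -- Cauchy–Schwarz in `ℝ≥0∞`
  have hNm : AEMeasurable (fun s => ENNReal.ofReal (N s)) (volume.restrict I) :=
    (ENNReal.measurable_ofReal.comp hNc.measurable).aemeasurable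
  have hCS : (∫⁻ s in I, ENNReal.ofReal (N s)) ^ (2 : ℝ) ≤
      (∫⁻ s in I, ENNReal.ofReal (N s ^ 2)) * volume I := by
    have h := ENNReal.lintegral_mul_le_Lp_mul_Lq (volume.restrict I) Real.HolderConjugate.two_two hNm
      (aemeasurable_const (b := (1 : ℝ≥0∞)))
    simp only [Pi.mul_apply, mul_one] at h
    have h2 := ENNReal.rpow_le_rpow h (show (0 : ℝ) ≤ 2 by norm_num)
    rw [ENNReal.mul_rpow_of_nonneg _ _ (by norm_num : (0 : ℝ) ≤ 2), ← ENNReal.rpow_mul, ← ENNReal.rpow_mul,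
      show (1 : ℝ) / 2 * 2 = 1 by norm_num, ENNReal.rpow_one, ENNReal.rpow_one] at h2
    have h3 : ∫⁻ s in I, ENNReal.ofReal (N s) ^ (2 : ℝ) = ∫⁻ s in I, ENNReal.ofReal (N s ^ 2) := by
      refine lintegral_congr fun s => ?_
      rw [ENNReal.ofReal_rpow_of_nonneg (hN0 s) (by norm_num), Real.rpow_two]
    have h4 : ∫⁻ _ in I, (1 : ℝ≥0∞) ^ (2 : ℝ) = volume I := by
      rw [ENNReal.one_rpow, setLIntegral_const, one_mul]
    rw [h3, h4] at h2
    exact h2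
  -- assemble
  have hvol : volume I ≤ ENNReal.ofReal (2 * A) := by
    rw [hI, Real.volume_uIoc, sub_zero]
    exact ENNReal.ofReal_le_ofReal hρ
  have hint : 0 ≤ ∫ s in I, N s := setIntegral_nonneg measurableSet_uIoc fun s _ => hN0 s
  calc ENNReal.ofReal (φ ρ ^ 2) = ENNReal.ofReal (|φ ρ|) ^ (2 : ℝ) := by
        rw [ENNReal.ofReal_rpow_of_nonneg (abs_nonneg _) (by norm_num), Real.rpow_two, sq_abs]
    _ ≤ ENNReal.ofReal (∫ s in I, N s) ^ (2 : ℝ) := by gcongr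
    _ = (∫⁻ s in I, ENNReal.ofReal (N s)) ^ (2 : ℝ) := by
        rw [ofReal_integral_eq_lintegral_ofReal hNint (Eventually.of_forall fun s => hN0 s)]
    _ ≤ (∫⁻ s in I, ENNReal.ofReal (N s ^ 2)) * volume I := hCS
    _ ≤ (∫⁻ s in Icc (-(2 * A)) (2 * A), ENNReal.ofReal (N s ^ 2)) * ENNReal.ofReal (2 * A) :=
        mul_le_mul' (lintegral_mono_set hIsub) hvol
    _ = ENNReal.ofReal (2 * A) * ∫⁻ s in Icc (-(2 * A)) (2 * A), ENNReal.ofReal (N s ^ 2) := mul_comm _ _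

/-- **Ray Poincaré on the square** `Q = [−2A,2A]²` (in the variables `(z, ρ)`): `∫_Q f(ρ,0,z)² ≤ 8A² ∫_Q ‖∇f(ρ,0,z)‖²`. [folklore] -/
theorem poincare_square {f : EuclideanSpace ℝ (Fin 3) → ℝ} (hfd : ContDiff ℝ 1 f)
    (haxis : ∀ x : EuclideanSpace ℝ (Fin 3), cylRadius x = 0 → f x = 0) {A : ℝ} (hA : 0 < A) :
    ∫⁻ y in Icc (-(2 * A)) (2 * A) ×ˢ Icc (-(2 * A)) (2 * A), ENNReal.ofReal (f (WithLp.toLp 2 ![y.2, 0, y.1]) ^ 2) ≤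
      ENNReal.ofReal (8 * A ^ 2) *
        ∫⁻ y in Icc (-(2 * A)) (2 * A) ×ˢ Icc (-(2 * A)) (2 * A), ENNReal.ofReal (‖fderiv ℝ f (WithLp.toLp 2 ![y.2, 0, y.1])‖ ^ 2) := by
  set J : Set ℝ := Icc (-(2 * A)) (2 * A) with hJ
  have hmerid : Continuous fun y : ℝ × ℝ => (WithLp.toLp 2 ![y.2, 0, y.1] : EuclideanSpace ℝ (Fin 3)) := by
    refine (PiLp.continuous_toLp 2 _).comp (continuous_pi fun i => ?_)
    fin_cases i
    · exact continuous_snd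
    · exact continuous_const
    · exact continuous_fst
  set G : ℝ × ℝ → ℝ≥0∞ := fun y => ENNReal.ofReal (f (WithLp.toLp 2 ![y.2, 0, y.1]) ^ 2) with hG
  set H : ℝ × ℝ → ℝ≥0∞ := fun y => ENNReal.ofReal (‖fderiv ℝ f (WithLp.toLp 2 ![y.2, 0, y.1])‖ ^ 2) with hH
  have hGm : Measurable G := ENNReal.measurable_ofReal.comp ((hfd.continuous.comp hmerid).pow 2).measurable
  have hHm : Measurable H :=
    ENNReal.measurable_ofReal.comp (((hfd.continuous_fderiv one_ne_zero).comp hmerid).norm.pow 2).measurable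
  have hμ : ((volume : Measure ℝ).restrict J).prod ((volume : Measure ℝ).restrict J) =
      (volume : Measure (ℝ × ℝ)).restrict (J ×ˢ J) := by
    rw [Measure.prod_restrict, ← Measure.volume_eq_prod]
  -- pointwise in `z`: `∫_J G(z,·) ≤ 4A · 2A ∫_J H(z,·)`
  have hz : ∀ z : ℝ, ∫⁻ ρ in J, G (z, ρ) ≤ ENNReal.ofReal (8 * A ^ 2) * ∫⁻ s in J, H (z, s) := by
    intro z
    calc ∫⁻ ρ in J, G (z, ρ) ≤ ∫⁻ _ in J, ENNReal.ofReal (2 * A) * ∫⁻ s in J, H (z, s) := by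
          refine setLIntegral_mono' measurableSet_Icc fun ρ hρ => ?_
          exact sq_le_ray_energy hfd haxis hA z (abs_le.2 ⟨by linarith [hρ.1], hρ.2⟩)
      _ = ENNReal.ofReal (2 * A) * (∫⁻ s in J, H (z, s)) * volume J := by rw [setLIntegral_const]
      _ = ENNReal.ofReal (8 * A ^ 2) * ∫⁻ s in J, H (z, s) := by
          rw [hJ, Real.volume_Icc, show 2 * A - -(2 * A) = 4 * A by ring, mul_comm _ (ENNReal.ofReal (4 * A)), ← mul_assoc,
            ← ENNReal.ofReal_mul (by positivity), show 4 * A * (2 * A) = 8 * A ^ 2 by ring]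
  rw [← hμ, lintegral_prod _ (by rw [hμ]; exact hGm.aemeasurable), lintegral_prod _ (by rw [hμ]; exact hHm.aemeasurable),
    ← lintegral_const_mul' _ _ ENNReal.ofReal_ne_top]
  exact lintegral_mono fun z => hz z

end Summit.NavierStokesRegularity.NavierStokesRegularity.Theorems.PowerGaugeEulerLiouville.SwirlCapacity

end
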